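import Mathlib
import HarnessLib
import Summits.HubbardSuperconductivity.HubbardSuperconductivity.Theorems.KLProgrammeKLRegimeTwoVolumeTowerSrcScaledDefs
import Summits.HubbardSuperconductivity.HubbardSuperconductivity.Theorems.KLProgrammeKLRegimeTwoVolumeTowerTruncSpineSW
import Summits.HubbardSuperconductivity.HubbardSuperconductivity.Theorems.KLProgrammeKLRegimeTwoVolumeTowerTruncEndSW
import Summits.HubbardSuperconductivity.HubbardSuperconductivity.Theorems.KLProgrammeKLRegimeTwoVolumeTowerTruncEndDoor
import Summits.HubbardSuperconductivity.HubbardSuperconductivity.Theorems.KLProgrammeKLRegimeVolumeLimitV9GluedSrcPairDoorAt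
import Summits.HubbardSuperconductivity.HubbardSuperconductivity.Theorems.KLProgrammeKLRegimeTwoVolumeSourceSmoothStateKit
import Summits.HubbardSuperconductivity.HubbardSuperconductivity.Theorems.KLProgrammeKLRegimeTwoVolumeTowerTruncEndDoorW

/-!
# [«(VL)-SRC-WINDOW» SW twin (k3c4-p1 g16, filed by g17 under the pen's (R235) «KEY = WINDOW»): `klTowerStateS ↦ klTowerStateSW` etc.; proofs token-identical]
# Route `KLProgramme` — crux K3, VL child `KLRegimeVolumeLimitV17F2` (stmt-HubbardSuperconductivity-20440), blueprint v5 M5 / W7-TS: THE CLOSER OF THE VL CHILD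
# MODULO THE SOURCE-RESCALED TRUNCATED DATA PACKAGE `TowerDataTSW β U μ t` (located «SRC-DEG2», cure (β) of plan g22 (R171); seat hubbard-kl-k3c4-p1 g15;
# `--supports` 20440)

Twin of `…TwoVolumeTowerTruncCloser` (p620176) one level up: from an inhabitant of `…TowerSrcScaledDefs.TowerDataTSW β U μ t`, `0 < t ≤ 1` ([BGM06] §2.9: the
source legs rescaled by `t`), the rescaled spine (`…TowerTruncSpineS`) and the rescaled end (`…TowerTruncEndS`) give the keyed defect of the two RESCALED
truncated read-outs uniformly small; the READ-BACK `…TowerSrcScaledKit.sum_filter_norm_keyed_kernel_srcTrunc_le_inv_pow_mul` (factor `t⁻²`: the truncated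
strings carry at most two source legs) turns it into the hypothesis of the landed door shape `…TowerTruncEndDoor.towerTrunc_end_glued_inner` (p619707, reused
verbatim), whence the door's inner text and, through k3c5-p3's door, the registered statement of `stub_vl_nestedFramed`.

* **`gluedInner_of_towerDataTSW`**, **`stub_vl_nestedFramed_of_towerDataTSW`** (v9 producer text; the v10/v11 text is `…TowerTruncCloserLevS`).

Proofs only; no definition.  Honest framing: a conditional closer; nothing here asserts the data, the stub, K3 or superconductivity.
-/

noncomputable section

namespace Summit.HubbardSuperconductivity.HubbardSuperconductivity.Theorems.TwoVolumeSource

set_option linter.dupNamespace false -- summit = problem name (single-conjunct summit), D-0017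

open Finset Filter Topology Literature.MathematicalPhysics.QuantumLattice GrassmannAlgebra Literature.Probability.LatticeModels
  Literature.Probability.LatticeModels.BattleFederbush
open Summit.HubbardSuperconductivity.HubbardSuperconductivity.Theorems.TwoPointAssembly
open Summit.HubbardSuperconductivity.HubbardSuperconductivity.Theorems.KLRegimeSplit
open Summit.HubbardSuperconductivity.HubbardSuperconductivity.Theorems.KLProgrammeLegKernels
open Summit.HubbardSuperconductivity.HubbardSuperconductivity.Theorems.EngineV8
open Summit.HubbardSuperconductivity.HubbardSuperconductivity.Theorems.TwoVolumeDefect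

set_option maxHeartbeats 400000 in -- three large instantiations unified against each other
/-- **The door's inner text from the RESCALED data package**, fixed `(β, U, μ)` with `0 < β`, `t ∈ (0,1]`: rescaled spine (W5) → rescaled end (W6b) → read-back `t⁻²` → door shape (W6c).
[folklore: composition; cite: BenfattoGiulianiMastropietro2006, §2.7-§2.9 and §3] -/
theorem gluedInner_of_towerDataTSW (β U μ : ℝ) (hβ : 0 < β) {t : ℝ} (ht0 : 0 < t) (ht1 : t ≤ 1) (D : TowerDataTSW β U μ t) :
    ∃ L₀ : ℕ, ∃ δ : ℕ → ℝ, Tendsto δ atTop (𝓝 0) ∧ ∃ Rd : ℕ → ℕ, Tendsto Rd atTop atTop ∧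
      ∀ (L : ℕ) [NeZero L], L₀ ≤ L → ∀ (L'' : ℕ) [NeZero L''] (b : ℕ), L'' = b * L → ∃ M₀ : ℕ, ∀ (M : ℕ) [NeZero M], M₀ ≤ M →
        ∃ (J : ℕ) (e : (SpaceTimeIdx L'' M × SectorLeg (sectorCount J)) ≃ (Fin 2 → Fin b) × (SpaceTimeIdx L M × SectorLeg (sectorCount J)))
          (ed : SrcLabel L'' M J ≃ (Fin 2 → Fin b) × SrcLabel L M J),
          (∀ X' i, ((e X').1 i : ℕ) = (X'.1.2 i).val / L) ∧
          (∀ X', (e X').2 = ((X'.1.1, fun i => (((X'.1.2 i).val : ℕ) : ZMod L)), X'.2)) ∧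
          (∀ x s, ed (x, s) = ((e x).1, ((e x).2, s))) ∧
        ∃ of : SpaceTimeIdx L'' M, (∀ j, Rd L ≤ (of.2 j).val % L ∧ (of.2 j).val % L + Rd L < L) ∧
          2 * (imagTimeWeight β M)⁻¹ *
            (∑ X ∈ univ.filter (fun X : Fin 2 → SrcLabel L'' M J => X 0 = ((of, ((⟨0, sectorCount_pos _⟩, 0), 0)), 1) ∧ (X 1).2 = 1),
              ‖kernel ℂ (srcTrunc ℂ (fun Y : SrcLabel L'' M J => Y.2 = 1) 3
                    (ExteriorAlgebra.map (Matrix.toLin' (((imagTimeWeight β M : ℝ) : ℂ) •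
                        klSrcAnalysisAtW L'' M β μ (klFlowFrameU L'' M β U μ (nScales β + 1)) J))
                      (klEffectiveAction L'' M β U μ (klFlowFrameU L'' M β U μ (nScales β + 1)) klE0 (nScales β + 1)))) 2 X -
                  (if ∀ i, (ed (X i)).1 = (ed (X 0)).1 then
                    kernel ℂ (srcTrunc ℂ (fun Y : SrcLabel L M J => Y.2 = 1) 3
                      (ExteriorAlgebra.map (Matrix.toLin' (((imagTimeWeight β M : ℝ) : ℂ) •
                          klSrcAnalysisAtW L M β μ (klFlowFrameU L M β U μ (nScales β + 1)) J))
                        (klEffectiveAction L M β U μ (klFlowFrameU L M β U μ (nScales β + 1)) klE0 (nScales β + 1)))) 2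
                      (fun i => (ed (X i)).2)
                  else 0)‖) ≤ δ L := by
  -- the frames as a total function of the volume (the flow frame needs `NeZero V`)
  obtain ⟨Kfr, hK⟩ : ∃ Kfr : ℕ → ℕ → TrigPolyC4v, ∀ (V M : ℕ) [NeZero V] [NeZero M], Kfr V M = klFlowFrameU V M β U μ (nScales β + 1) :=
    ⟨fun V M => if hV : V = 0 then 0 else if hM : M = 0 then 0 else
        (haveI : NeZero V := ⟨hV⟩; haveI : NeZero M := ⟨hM⟩; klFlowFrameU V M β U μ (nScales β + 1)),
      fun V M _ _ => by simp only [dif_neg (NeZero.ne V), dif_neg (NeZero.ne M)]⟩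
  -- admissibility with a positive cutoff (the normalisation `ε_M = β/(2M)` is then positive)
  have hε : ∀ L b M, (D.Mth L b ≤ M ∧ 0 < M) → 0 < imagTimeWeight β M := fun L b M h => by
    have hM : (0 : ℝ) < M := Nat.cast_pos.2 h.2
    unfold imagTimeWeight; positivity
  have hdata' : ∀ᶠ L in atTop, ∀ (b M : ℕ) [NeZero L] [NeZero (b * L)] [NeZero M], (D.Mth L b ≤ M ∧ 0 < M) →
      TowerVolumeDataTSW L M β U μ (Kfr L M) (nScales β) (imagTimeWeight β M) t D.Λ D.κ D.aW D.sW D.NV ∧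
        TowerVolumeDataTSW (b * L) M β U μ (Kfr (b * L) M) (nScales β) (imagTimeWeight β M) t D.Λ D.κ D.aW D.sW D.NV ∧
          TowerCrossData L b M β μ (Kfr L M) (Kfr (b * L) M) (nScales β) (imagTimeWeight β M)
            D.Λ D.κ' D.aW' D.sW' D.eW' D.ΛT D.cW D.κf (fun j => D.sE j L) (fun j => D.cR j L) (fun j => D.cC j L) (fun j => D.δ j L) := by
    filter_upwards [D.hdata] with L hL
    intro b M iL ibL iM h
    rw [hK L M, hK (b * L) M]
    exact hL b M h.1
  have h0' : ∀ (k : ℕ) (η : ℝ), 0 < η → ∀ᶠ L in atTop, ∀ (b M : ℕ) [NeZero L] [NeZero (b * L)] [NeZero M], (D.Mth L b ≤ M ∧ 0 < M) →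
      ∀ (p : Fin k) (w : SrcLabel (b * L) M 0), (∀ i, 2 * D.r L ≤ (w.1.1.2 i).val % L ∧ (w.1.1.2 i).val % L + 2 * D.r L < L) →
        klKeyedDefectTSW L b M β U μ (Kfr L M) (Kfr (b * L) M) t 0 k p w ≤ imagTimeWeight β M * η := by
    intro k η hη
    filter_upwards [D.h0 k η hη] with L hL
    intro b M iL ibL iM h
    rw [hK L M, hK (b * L) M]
    exact hL b M h.1
  -- W5: the spine
  have hspine := towerTruncSW_keyedDefect_eventually_le β U μ hβ.ne' Kfr t (nScales β)
    (fun L b M => D.Mth L b ≤ M ∧ 0 < M) (fun M => imagTimeWeight β M) hε D.r D.hr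
    D.Λ D.κ D.aW D.sW D.κ' D.aW' D.sW' D.eW' D.ΛT D.cW D.κf D.cRb D.cCb D.δb D.ρ₀ D.ρf D.ρ₂ D.ρ' D.ρ₃ D.ν₀ D.ν₁ D.ν₂ D.ν₃ D.ν₄ D.ν₅ D.νE D.ν₆ D.ν₇ D.ν₈
    D.NV D.NS D.hΛ D.hΛmono D.hΛT D.hκ D.haW D.hρ D.hNV0 D.hNSnn D.hNS0 D.hNSsucc D.hsm D.sE D.cR D.cC D.δ D.hmis D.hmis0 hdata' h0'
    (nScales β) le_rfl
  -- W6b: the end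
  have hend := towerTruncSW_end_keyedDefect_eventually_le β U μ hβ.ne' Kfr t (nScales β)
    (fun L b M => D.Mth L b ≤ M ∧ 0 < M) (fun M => imagTimeWeight β M) hε D.r D.hr
    D.Λ D.κ D.aW D.sW D.κ' D.aW' D.sW' D.eW' D.ΛT D.cW D.κf D.ρ₀ D.ν₀ (D.δb (nScales β)) D.NV D.NS
    D.hΛ (D.hΛT _) (D.haW _).2.2.2.2.2.1 (fun j => (D.hρ j).1) D.hNV0 D.hNSnn (fun j hj => (D.hsm j hj).hν₀) (fun j hj => (D.hsm j hj).hθ₀) D.hNS0 D.hNSsucc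
    D.sE D.cR D.cC D.δ (fun L => ⟨(D.hmis _ L).2.2.2.1, (D.hmis _ L).2.2.2.2.2.2⟩) (D.hmis0 _).2.2.2 hdata' hspine
  -- W6c: the door's shape (instances with a positive cutoff are the admissible ones; frames by name)
  -- READ-BACK: the unscaled truncated read-outs' keyed defect is at most `t⁻² ×` that of the rescaled ones (strings with `< 3` source legs)
  refine towerTrunc_end_glued_innerW β U μ hβ D.Mth D.r D.hr D.hRd fun k η hη => ?_
  have hη' : 0 < t ^ 2 * η := by positivity
  filter_upwards [hend k (t ^ 2 * η) hη'] with L hL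
  intro b M iL ibL iM hM p w hw
  rw [← hK L M, ← hK (b * L) M]
  have hsc := hL b M ⟨hM, Nat.pos_of_ne_zero (NeZero.ne M)⟩ p w hw
  rw [klTowerDSW_eq_srcScale_srcSmooth, klTowerDSW_eq_srcScale_srcSmooth] at hsc
  have hcopy : ∀ y : SrcLabel (b * L) M (nScales β), ((klBlockEquivD L b M (nScales β) y).2).2 = y.2 := fun y => by
    obtain ⟨x, s⟩ := y; rw [klBlockEquivD_apply]
  have hε0 : 0 ≤ imagTimeWeight β M := (hε L b M ⟨hM, Nat.pos_of_ne_zero (NeZero.ne M)⟩).le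
  refine (sum_filter_norm_keyed_kernel_srcTrunc_le_inv_pow_mul (klBlockEquivD L b M (nScales β)) hcopy ht0 ht1 _ _ 3 k p _).trans ?_
  refine (mul_le_mul_of_nonneg_left hsc (by positivity)).trans (le_of_eq ?_)
  rw [show (3 - 1 : ℕ) = 2 from rfl, ← mul_assoc, mul_comm (t⁻¹ ^ 2) (imagTimeWeight β M), mul_assoc, ← mul_assoc (t⁻¹ ^ 2), ← mul_pow,
    inv_mul_cancel₀ ht0.ne', one_pow, one_mul]

/- The closer `stub_vl_nestedFramed_of_towerDataTSW` = `gluedInner_of_towerDataTSW` ∘ the (β) door (twin of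
`…VolumeLimitV10GluedSrcPairDoorAt.stub_vl_nestedFramed_of_gluedSrcDefect_keyedAt` for `klSrcAnalysisAtW` objects) — added when (β) lands. -/

end Summit.HubbardSuperconductivity.HubbardSuperconductivity.Theorems.TwoVolumeSource

end
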